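import Literature.Analysis.OperatorTheory.HermitianKernelOperator
import Literature.Analysis.OperatorTheory.IntegralOperatorHilbertSchmidt
import HarnessLib

/-!
# Stub `stub_spectralTraceC` of line `twisted_trace_transfer` for crux `QuarksAsStableAction.StableActionBridge`
# (stmt-QuantumFields-9737): the spectral trace formula with one diagonal insertion, complex Hermitian kernels

This is the registered stub `stub_spectralTraceC` (sub-goal A2 of §8 E3 of the line skeleton
`twisted_trace_transfer` for the crux `Summit.QuantumFields.QCD.Theses.QuarksAsStableAction.StableActionBridge`,
item stmt-QuantumFields-9737): the complex Hermitian port of the tree's real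
`Literature.Analysis.OperatorTheory.hasSum_pow_integral_iterate_diag` (`PositiveKernelSpectralTrace.lean`) with ONE
bounded diagonal insertion `F` and WITHOUT a sign hypothesis on the eigenvalues.

Setting: `(Y, ρ)` a finite measure space, `K : Y → Y → ℂ` strongly measurable, bounded (`‖K x y‖ ≤ C`) and Hermitian
(`K(x,y) = conj K(y,x)`), `A` a bounded operator on `L²(ρ; ℂ) = Lp ℂ 2 ρ` with the a.e. kernel formula
`A φ =ᵐ ∫ K(·,y) φ(y) dρ(y)`, `b` a countable Hilbert basis of eigenvectors, `A bᵢ = λᵢ bᵢ` with `λᵢ ∈ ℝ`, and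
`F : Y → ℂ` measurable and bounded.  With the POINTWISE kernel operator `(κ f)(w) = ∫ K(w,z) f(z) dρ(z)` the claim is
`∫ F(x) (κ^[M+1] K(·, x))(x) dρ(x) = Σᵢ λᵢ^{M+2} ∫ F |bᵢ|² dρ` as a `HasSum` — `Tr(F A^{M+2})` without a trace class.

Proof (sub-namespace `StubSpectralTraceC`), following the real file:
* kernel sections: by Hermiticity `z ↦ K(z, x)` is `z ↦ conj K(x, z) ∈ L²`, whose class `s_x` satisfies
  `⟪s_x, φ⟫ = ∫ K(x,z) φ(z)` (tree: `memLp_two_conj_kernel_section`, `integral_kernel_mul_eq_inner`; Mathlib's inner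
  product is conjugate-linear in the first slot);
* bridge: `A^j [h] =ᵐ κ^[j] h` (`pow_toLp_ae_eq_iterate`), hence `(κ^[j+1] h)(x) = ⟪s_x, A^j [h]⟫` for EVERY `x`
  (`iterate_succ_apply_eq_inner`);
* Parseval (`HilbertBasis.hasSum_inner_mul_inner`) and self-adjointness of `A`
  (`isSelfAdjoint_of_ae_hermitianKernel`): `⟪s_x, A^M s_x⟫ = Σᵢ ⟪s_x, bᵢ⟫ ⟪bᵢ, A^M s_x⟫ = Σᵢ λᵢ^M |cᵢ(x)|²` with
  `cᵢ(x) = ∫ K(x,z) bᵢ(z)` (`hasSum_iterate_diag`), for every `x`;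
* `cᵢ =ᵐ λᵢ bᵢ` (the kernel formula on `bᵢ`), so `∫ F λᵢ^M |cᵢ|² = λᵢ^{M+2} ∫ F |bᵢ|²` (`integral_term`);
* interchange of `∫` and `Σᵢ` by dominated convergence (`hasSum_integral_of_dominated_convergence`) with the bound
  `|F λᵢ^M cᵢ²| ≤ B_F ‖A‖^M |cᵢ|²`, `Σᵢ |cᵢ(x)|² = ∫ |K(x,·)|² ≤ C² ρ(Y)` (pointwise Parseval,
  `hasSum_norm_sq_integral_kernel_mul`) — no sign condition on `λᵢ` is needed.

Mathlib + `HermitianKernelOperator` + `IntegralOperatorHilbertSchmidt` only; theorems only, no definitions.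
References: M. Reed, B. Simon, *Methods of Modern Mathematical Physics I* (1980), Thm. VI.22–VI.23; B. Simon,
*Trace Ideals and Their Applications* (2005), Thm. 3.1. [folklore]
-/

noncomputable section

open MeasureTheory Filter Set Function
open scoped InnerProductSpace ComplexConjugate Matrix BigOperators ENNReal

namespace Summit.QuantumFields.QCD.Cruxes.StableActionBridge.TwistedTraceTransfer

namespace StubSpectralTraceC

open Literature.Analysis.OperatorTheory

variable {Y : Type*} [MeasurableSpace Y] {ρ : Measure Y} [IsFiniteMeasure ρ]
  {K : Y → Y → ℂ} {C : ℝ} {A : Lp ℂ 2 ρ →L[ℂ] Lp ℂ 2 ρ} {ι : Type*}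
  {b : HilbertBasis ι ℂ (Lp ℂ 2 ρ)} {lam : ι → ℝ}

/-! ### Eigenbasis bookkeeping -/

omit [IsFiniteMeasure ρ] in
/-- Powers act diagonally on an eigenbasis: `A^j bᵢ = λᵢ^j bᵢ`. [folklore] -/
theorem pow_apply_basis (hb : ∀ i, A (b i) = (lam i : ℂ) • (b i : Lp ℂ 2 ρ)) (j : ℕ) (i : ι) :
    (A ^ j) (b i) = (lam i : ℂ) ^ j • (b i : Lp ℂ 2 ρ) := by
  induction j with
  | zero => simp
  | succ j ih =>
    rw [pow_succ', mul_apply_eq_comp, ih, map_smul, hb, smul_smul, pow_succ, mul_comm]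

omit [IsFiniteMeasure ρ] in
/-- `|λᵢ| ≤ ‖A‖` for the eigenvalues of an orthonormal eigenbasis. [folklore] -/
theorem abs_lam_le_norm (hb : ∀ i, A (b i) = (lam i : ℂ) • (b i : Lp ℂ 2 ρ)) (i : ι) : |lam i| ≤ ‖A‖ := by
  have h1 : ‖A (b i)‖ = |lam i| := by
    rw [hb, norm_smul, Complex.norm_real, Real.norm_eq_abs, b.orthonormal.norm_eq_one i, mul_one]
  rw [← h1]
  calc ‖A (b i)‖ ≤ ‖A‖ * ‖b i‖ := A.le_opNorm _
    _ = ‖A‖ := by rw [b.orthonormal.norm_eq_one i, mul_one]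

omit [IsFiniteMeasure ρ] in
/-- Matrix elements of the powers of the SELF-ADJOINT `A` against an eigenvector with REAL eigenvalue:
`⟪bᵢ, A^j v⟫ = λᵢ^j ⟪bᵢ, v⟫`. [folklore] -/
theorem inner_basis_pow_apply (hsa : IsSelfAdjoint A) (hb : ∀ i, A (b i) = (lam i : ℂ) • (b i : Lp ℂ 2 ρ))
    (j : ℕ) (i : ι) (v : Lp ℂ 2 ρ) :
    ⟪(b i : Lp ℂ 2 ρ), (A ^ j) v⟫_ℂ = (lam i : ℂ) ^ j * ⟪(b i : Lp ℂ 2 ρ), v⟫_ℂ := by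
  have hsaj : IsSelfAdjoint (A ^ j) := hsa.pow j
  rw [← hsaj.adjoint_eq, ContinuousLinearMap.adjoint_inner_right, pow_apply_basis hb j i, inner_smul_left,
    map_pow, Complex.conj_ofReal]

/-! ### Kernel sections and the iterate bridge -/

omit [IsFiniteMeasure ρ] in
/-- **`A^j [h] = κ^[j] h` almost everywhere** for `h ∈ ℒ²` (`[h]` its `L²` class, `κ f = ∫ K(·,z) f(z) dρ(z)` the
pointwise kernel operator). [folklore] -/
theorem pow_toLp_ae_eq_iterate
    (hA : ∀ φ : Lp ℂ 2 ρ, (A φ : Y → ℂ) =ᵐ[ρ] fun x => ∫ y, K x y * φ y ∂ρ)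
    {h : Y → ℂ} (hh : MemLp h 2 ρ) (j : ℕ) :
    ((A ^ j) (hh.toLp h) : Y → ℂ) =ᵐ[ρ] (fun f : Y → ℂ => fun w => ∫ z, K w z * f z ∂ρ)^[j] h := by
  induction j with
  | zero =>
    simp only [pow_zero, one_apply_eq_self, Function.iterate_zero, id_eq]
    exact hh.coeFn_toLp
  | succ j ih =>
    rw [pow_succ', mul_apply_eq_comp, Function.iterate_succ_apply']
    filter_upwards [hA ((A ^ j) (hh.toLp h))] with x hx
    rw [hx]
    exact integral_congr_ae (by filter_upwards [ih] with y hy; rw [hy])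

/-- **The bridge**: `(κ^[j+1] h)(x) = ⟪\overline{K(x,·)}, A^j [h]⟫` for EVERY `x` — the last kernel integration is
an honest integral. [folklore] -/
theorem iterate_succ_apply_eq_inner (hK : StronglyMeasurable (uncurry K)) (hC : ∀ x y, ‖K x y‖ ≤ C)
    (hA : ∀ φ : Lp ℂ 2 ρ, (A φ : Y → ℂ) =ᵐ[ρ] fun x => ∫ y, K x y * φ y ∂ρ)
    {h : Y → ℂ} (hh : MemLp h 2 ρ) (j : ℕ) (x : Y) :
    ((fun f : Y → ℂ => fun w => ∫ z, K w z * f z ∂ρ)^[j + 1] h) x =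
      ⟪(memLp_two_conj_kernel_section hK hC x).toLp _, (A ^ j) (hh.toLp h)⟫_ℂ := by
  rw [Function.iterate_succ_apply', ← integral_kernel_mul_eq_inner hK hC x]
  refine integral_congr_ae ?_
  filter_upwards [pow_toLp_ae_eq_iterate hA hh j] with y hy
  rw [hy]

/-! ### The pointwise spectral expansion of the diagonal of the iterated kernel -/

/-- **`(κ^[j+1] K(·,x))(x) = Σᵢ λᵢ^j |∫ K(x,z) bᵢ(z) dρ(z)|²` for EVERY `x`** (the Hermitian section
`K(·,x) = \overline{K(x,·)}`, the bridge, Parseval `HilbertBasis.hasSum_inner_mul_inner` and self-adjointness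
of `A`). [folklore] -/
theorem hasSum_iterate_diag (hK : StronglyMeasurable (uncurry K)) (hC : ∀ x y, ‖K x y‖ ≤ C)
    (hherm : ∀ x y, K x y = conj (K y x))
    (hA : ∀ φ : Lp ℂ 2 ρ, (A φ : Y → ℂ) =ᵐ[ρ] fun x => ∫ y, K x y * φ y ∂ρ)
    (hb : ∀ i, A (b i) = (lam i : ℂ) • (b i : Lp ℂ 2 ρ)) (j : ℕ) (x : Y) :
    HasSum (fun i => (lam i : ℂ) ^ j * ((‖∫ z, K x z * (b i : Lp ℂ 2 ρ) z ∂ρ‖ ^ 2 : ℝ) : ℂ))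
      (((fun f : Y → ℂ => fun w => ∫ z, K w z * f z ∂ρ)^[j + 1] (fun z => K z x)) x) := by
  have hsec : (fun z => K z x) = fun z => conj (K x z) := funext fun z => hherm z x
  rw [hsec, iterate_succ_apply_eq_inner hK hC hA (memLp_two_conj_kernel_section hK hC x) j x]
  have hsa : IsSelfAdjoint A := isSelfAdjoint_of_ae_hermitianKernel hK hC hherm hA
  have h := b.hasSum_inner_mul_inner ((memLp_two_conj_kernel_section hK hC x).toLp _)
    ((A ^ j) ((memLp_two_conj_kernel_section hK hC x).toLp _))
  refine h.congr_fun fun i => ?_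
  rw [inner_basis_pow_apply hsa hb j i, ← inner_conj_symm (b i : Lp ℂ 2 ρ),
    ← integral_kernel_mul_eq_inner hK hC x (b i), ← Complex.normSq_eq_norm_sq, ← Complex.mul_conj]
  ring

/-! ### The section coefficients `cᵢ = κ bᵢ` -/

omit [IsFiniteMeasure ρ] in
/-- `κ bᵢ = λᵢ bᵢ` almost everywhere (the kernel formula on the eigenvector `bᵢ`). [folklore] -/
theorem integral_kernel_mul_basis_ae_eq
    (hA : ∀ φ : Lp ℂ 2 ρ, (A φ : Y → ℂ) =ᵐ[ρ] fun x => ∫ y, K x y * φ y ∂ρ)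
    (hb : ∀ i, A (b i) = (lam i : ℂ) • (b i : Lp ℂ 2 ρ)) (i : ι) :
    (fun x => ∫ z, K x z * (b i : Lp ℂ 2 ρ) z ∂ρ) =ᵐ[ρ] fun x => (lam i : ℂ) * (b i : Lp ℂ 2 ρ) x := by
  have h1 := hA (b i)
  rw [hb] at h1
  filter_upwards [h1, Lp.coeFn_smul (lam i : ℂ) (b i : Lp ℂ 2 ρ)] with x hx hx'
  rw [← hx, hx', Pi.smul_apply, smul_eq_mul]

omit [IsFiniteMeasure ρ] in
/-- **The terms**: `∫ F · λᵢ^M |κ bᵢ|² dρ = λᵢ^{M+2} ∫ F |bᵢ|² dρ`. [folklore] -/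
theorem integral_term (hA : ∀ φ : Lp ℂ 2 ρ, (A φ : Y → ℂ) =ᵐ[ρ] fun x => ∫ y, K x y * φ y ∂ρ)
    (hb : ∀ i, A (b i) = (lam i : ℂ) • (b i : Lp ℂ 2 ρ)) (F : Y → ℂ) (M : ℕ) (i : ι) :
    ∫ x, F x * ((lam i : ℂ) ^ M * ((‖∫ z, K x z * (b i : Lp ℂ 2 ρ) z ∂ρ‖ ^ 2 : ℝ) : ℂ)) ∂ρ =
      (lam i : ℂ) ^ (M + 2) * ∫ x, F x * ((‖(b i : Lp ℂ 2 ρ) x‖ ^ 2 : ℝ) : ℂ) ∂ρ := by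
  rw [← integral_const_mul]
  refine integral_congr_ae ?_
  filter_upwards [integral_kernel_mul_basis_ae_eq hA hb i] with x hx
  rw [hx]
  simp only [norm_mul, mul_pow, Complex.norm_real, Real.norm_eq_abs, sq_abs, Complex.ofReal_mul,
    Complex.ofReal_pow]
  ring

/-- `∫ |K(x,·)|² dρ ≤ C² ρ(Y)`. [folklore] -/
theorem integral_norm_kernel_sq_le (hC : ∀ x y, ‖K x y‖ ≤ C) (x : Y) :
    ∫ z, ‖K x z‖ ^ 2 ∂ρ ≤ C ^ 2 * ρ.real univ := by
  have h1 : ‖∫ z, ‖K x z‖ ^ 2 ∂ρ‖ ≤ C ^ 2 * ρ.real univ :=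
    norm_integral_le_of_norm_le_const (Eventually.of_forall fun z => by
      rw [Real.norm_of_nonneg (by positivity)]
      exact pow_le_pow_left₀ (norm_nonneg _) (hC x z) 2)
  exact (Real.le_norm_self _).trans h1

/-! ### Trace with one diagonal insertion -/

/-- **`∫ F(x) (κ^[M+1] K(·,x))(x) dρ(x) = Σᵢ λᵢ^{M+2} ∫ F |bᵢ|² dρ`** (`Tr(F A^{M+2})` without a trace class) for a
bounded Hermitian kernel, an eigenbasis with real eigenvalues and a bounded measurable insertion `F`: the pointwise
expansion `hasSum_iterate_diag` integrated term by term by dominated convergence with the bound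
`B_F ‖A‖^M Σᵢ |κ bᵢ(x)|² = B_F ‖A‖^M ∫ |K(x,·)|² ≤ B_F ‖A‖^M C² ρ(Y)`. [folklore] -/
theorem hasSum_insert_diag [Countable ι] (hK : StronglyMeasurable (uncurry K)) (hC : ∀ x y, ‖K x y‖ ≤ C)
    (hherm : ∀ x y, K x y = conj (K y x))
    (hA : ∀ φ : Lp ℂ 2 ρ, (A φ : Y → ℂ) =ᵐ[ρ] fun x => ∫ y, K x y * φ y ∂ρ)
    (hb : ∀ i, A (b i) = (lam i : ℂ) • (b i : Lp ℂ 2 ρ)) {F : Y → ℂ} {BF : ℝ} (hF : Measurable F)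
    (hBF : ∀ y, ‖F y‖ ≤ BF) (M : ℕ) :
    HasSum (fun i => (lam i : ℂ) ^ (M + 2) * ∫ x, F x * ((‖(b i : Lp ℂ 2 ρ) x‖ ^ 2 : ℝ) : ℂ) ∂ρ)
      (∫ x, F x * ((fun f : Y → ℂ => fun w => ∫ z, K w z * f z ∂ρ)^[M + 1] (fun z => K z x)) x ∂ρ) := by
  -- the section coefficients `c i x = (κ bᵢ)(x)`
  set c : ι → Y → ℂ := fun i x => ∫ z, K x z * (b i : Lp ℂ 2 ρ) z ∂ρ with hc
  have hcm : ∀ i, Measurable (c i) := fun i => (stronglyMeasurable_integral_kernel_mul hK (b i)).measurable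
  have hlamA : ∀ i, |lam i| ≤ ‖A‖ := abs_lam_le_norm hb
  have hpars : ∀ x, HasSum (fun i => ‖c i x‖ ^ 2) (∫ z, ‖K x z‖ ^ 2 ∂ρ) := fun x =>
    hasSum_norm_sq_integral_kernel_mul hK hC b x
  have key := hasSum_integral_of_dominated_convergence (μ := ρ)
    (F := fun i x => F x * ((lam i : ℂ) ^ M * ((‖c i x‖ ^ 2 : ℝ) : ℂ)))
    (f := fun x => F x * ((fun f : Y → ℂ => fun w => ∫ z, K w z * f z ∂ρ)^[M + 1] (fun z => K z x)) x)
    (fun i x => BF * ‖A‖ ^ M * ‖c i x‖ ^ 2) (fun i => ?_) (fun i => ?_) ?_ ?_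
    (Eventually.of_forall fun x => (hasSum_iterate_diag hK hC hherm hA hb M x).mul_left (F x))
  · -- identify the terms
    refine key.congr_fun fun i => ?_
    exact (integral_term hA hb F M i).symm
  · -- measurability of the terms
    exact (hF.mul ((Complex.measurable_ofReal.comp ((hcm i).norm.pow_const 2)).const_mul _)).aestronglyMeasurable
  · -- the domination `|F λᵢ^M cᵢ²| ≤ B_F ‖A‖^M |cᵢ|²`
    refine Eventually.of_forall fun x => ?_
    have hBF0 : 0 ≤ BF := (norm_nonneg _).trans (hBF x)
    calc ‖F x * ((lam i : ℂ) ^ M * ((‖c i x‖ ^ 2 : ℝ) : ℂ))‖ = ‖F x‖ * (|lam i| ^ M * ‖c i x‖ ^ 2) := by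
          simp only [norm_mul, norm_pow, Complex.norm_real, Real.norm_eq_abs, abs_norm]
      _ ≤ BF * (‖A‖ ^ M * ‖c i x‖ ^ 2) :=
          mul_le_mul (hBF x) (mul_le_mul_of_nonneg_right (pow_le_pow_left₀ (abs_nonneg _) (hlamA i) M)
            (sq_nonneg _)) (by positivity) hBF0
      _ = BF * ‖A‖ ^ M * ‖c i x‖ ^ 2 := (mul_assoc _ _ _).symm
  · -- summability of the dominating sequence
    exact Eventually.of_forall fun x => (hpars x).summable.mul_left _
  · -- integrability of its sum `B_F ‖A‖^M ∫ |K(x,·)|²`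
    have hfun : (fun x => ∑' i, BF * ‖A‖ ^ M * ‖c i x‖ ^ 2) = fun x => BF * ‖A‖ ^ M * ∫ z, ‖K x z‖ ^ 2 ∂ρ := by
      funext x
      rw [tsum_mul_left, (hpars x).tsum_eq]
    rw [hfun]
    exact (Integrable.of_bound (stronglyMeasurable_integral_norm_kernel_sq hK).aestronglyMeasurable
      (C ^ 2 * ρ.real univ) (Eventually.of_forall fun x => by
        rw [Real.norm_of_nonneg (integral_nonneg fun z => by positivity)]
        exact integral_norm_kernel_sq_le hC x)).const_mul _

end StubSpectralTraceC

/-- **Sub-goal A2 of line `twisted_trace_transfer` (registered stub `stub_spectralTraceC`; complex Hermitian port of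
`Literature.Analysis.OperatorTheory.hasSum_pow_integral_iterate_diag` with ONE bounded diagonal insertion).**  For a
bounded, strongly measurable, HERMITIAN kernel `K` (`K(x,y) = conj K(y,x)`) on a finite measure space, a bounded
operator `A` on `L²(ρ; ℂ)` with the a.e. kernel formula, a countable Hilbert basis `b` of eigenvectors
(`A bᵢ = λᵢ bᵢ`, `λᵢ ∈ ℝ`) and a bounded measurable `F : Y → ℂ`:
`∫ F(x) K^{(M+2)}(x, x) dρ(x) = Σᵢ λᵢ^{M+2} ∫ F |bᵢ|² dρ` as an unconditional sum, where
`K^{(M+2)}(x,x) = (κ^[M+1] K(·, x))(x)`, `κ f = ∫ K(·,z) f(z) dρ(z)`; NO sign hypothesis on `λᵢ`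
(`StubSpectralTraceC.hasSum_insert_diag`). [folklore] -/
theorem stub_spectralTraceC : ∀ (Y : Type) [MeasurableSpace Y] (ρ : Measure Y) [IsFiniteMeasure ρ]
    (K : Y → Y → ℂ) (C : ℝ), StronglyMeasurable (Function.uncurry K) → (∀ x y, ‖K x y‖ ≤ C) →
    (∀ x y, K x y = (starRingEnd ℂ) (K y x)) →
    ∀ A : Lp ℂ 2 ρ →L[ℂ] Lp ℂ 2 ρ, (∀ φ : Lp ℂ 2 ρ, (A φ : Y → ℂ) =ᵐ[ρ] fun x => ∫ y, K x y * φ y ∂ρ) →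
    ∀ (ι : Type) [Countable ι] (b : HilbertBasis ι ℂ (Lp ℂ 2 ρ)) (lam : ι → ℝ),
      (∀ i, A (b i) = (lam i : ℂ) • (b i : Lp ℂ 2 ρ)) →
    ∀ (F : Y → ℂ) (BF : ℝ), Measurable F → (∀ y, ‖F y‖ ≤ BF) → ∀ M : ℕ,
      HasSum (fun i => (lam i : ℂ) ^ (M + 2) * ∫ x, F x * ((‖(b i : Lp ℂ 2 ρ) x‖ ^ 2 : ℝ) : ℂ) ∂ρ)
        (∫ x, F x * ((fun f : Y → ℂ => fun w => ∫ z, K w z * f z ∂ρ)^[M + 1] (fun z => K z x)) x ∂ρ) := by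
  intro Y _ ρ _ K C hK hC hherm A hA ι _ b lam hb F BF hF hBF M
  exact StubSpectralTraceC.hasSum_insert_diag hK hC hherm hA hb hF hBF M

end Summit.QuantumFields.QCD.Cruxes.StableActionBridge.TwistedTraceTransfer

end
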